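import Summits.CriticalPhenomena.PercolationContinuityZ3.Theorems.PercNearOneGluingNoHeavyLowerTailOneCutFiveDownstream
import Summits.CriticalPhenomena.PercolationContinuityZ3.Theorems.PercNearOneGluingNoHeavyLowerTailOneCutFiveLeSix
import HarnessLib

/-!
# `NoHeavyLowerTail` (crux stmt-CriticalPhenomena-4575) — the `|A| ≤ 5` consequences of the one-cut rung, UNCONDITIONALLY
# on every weighted graph with at most six vertices

Support file (prover seat `prim-a5-assembly-2`; `--supports stmt-CriticalPhenomena-4575`).  COMPUTATIONAL ANCESTRY: the input
`oneCut5_le_six` (prim-cert-2, `…OneCutFiveLeSix`) rests on eight `native_decide` box certificates; this file adds no computation.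

For `n ≤ 6`, `μ = prodBernoulli w` on `Fin n`, a relay set `A` with `A.card ≤ 5`, an observer `o`, a target `b`, and `δ ≥ μ(a ↮ b)`
for all `a ∈ A`:
* `OneCutDownstream.oneCut_card_le_five_le_six` — the one-cut bound `μ{1 ≤ N < E N/2} ≤ t` for every `t ≥ 0` bounding the relay–relay
  cuts (`oneCut5_le_six` for `|A| = 5`, the tree's `oneCut_card_le_four` for `|A| ≤ 4`);
* `OneCutDownstream.lowerTail_card_le_five_le_six` — `μ{1 ≤ N < E N/2} ≤ 2δ`;
* `OneCutDownstream.linearGluing_card_le_five_le_six` — `1 − μ(o ↔ b) ≤ (1 − μ(o ↔ A)) + 4δ` (`linearGluing_of_oneCutAt`).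
So on `≤ 6` vertices the whole `|A| ≤ 5` package of `…OneCutFiveDownstream` is a theorem; the first open case of the rung is `n = 7`,
`|A| = 5`, `E N > 4` (ASSEMBLY.md §0/§5 of run/shared/lean/prim/prim-a5).  HONEST LABEL: toward `|A| = 5` of the one-arm near-critical
percolation programme (crux 4575); nothing here asserts the crux.
-/

noncomputable section

namespace Summit.CriticalPhenomena.PercolationContinuityZ3.Theorems

namespace OneCutDownstream

open MeasureTheory Set Literature.Probability.LatticeModels Literature.Probability.Percolation
open scoped Classical BigOperators

/-- **The one-cut bound for `|A| ≤ 5` on at most six vertices** (`oneCut5_le_six` + `oneCut_card_le_four`).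
COMPUTATIONAL ancestry via `oneCut5_le_six`. [this work] -/
theorem oneCut_card_le_five_le_six :
    ∀ (n : ℕ), n ≤ 6 → ∀ (w : Sym2 (Fin n) → unitInterval) (A : Finset (Fin n)) (o : Fin n) (t : ℝ), A.card ≤ 5 → 0 ≤ t →
      (∀ a ∈ A, ∀ a' ∈ A, a ≠ a' →
        (Literature.Probability.LatticeModels.prodBernoulli w).real
          (Literature.Probability.Percolation.openConn a a')ᶜ ≤ t) →
      (Literature.Probability.LatticeModels.prodBernoulli w).real
        {ω : Literature.Probability.Percolation.BondConfig (Fin n) |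
          1 ≤ (A.filter fun a => ω ∈ Literature.Probability.Percolation.openConn o a).card ∧
          ((A.filter fun a => ω ∈ Literature.Probability.Percolation.openConn o a).card : ℝ) <
            (∑ a ∈ A, (Literature.Probability.LatticeModels.prodBernoulli w).real
              (Literature.Probability.Percolation.openConn o a)) / 2} ≤ t := by
  intro n hn w A o t hA ht hpair
  rcases Nat.lt_or_ge A.card 5 with hlt | hge
  · exact oneCut_card_le_four n w A o t (by omega) ht hpair
  · exact oneCut5_le_six n hn w A o t (le_antisymm hA hge) ht hpair

/-- **Lower-tail bound for `|A| ≤ 5` on at most six vertices**: if `μ(a ↮ b) ≤ δ` for all `a ∈ A` then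
`μ{1 ≤ N < E N/2} ≤ 2δ`.  COMPUTATIONAL ancestry via `oneCut5_le_six`. [this work] -/
theorem lowerTail_card_le_five_le_six {n : ℕ} (hn : n ≤ 6) (w : Sym2 (Fin n) → unitInterval) (A : Finset (Fin n))
    (o b : Fin n) (hA : A.card ≤ 5) (δ : ℝ) (hδ : 0 ≤ δ)
    (hAb : ∀ a ∈ A, (prodBernoulli w).real (openConn a b : Set (BondConfig (Fin n)))ᶜ ≤ δ) :
    (prodBernoulli w).real {ω : BondConfig (Fin n) |
        1 ≤ (A.filter fun a => ω ∈ openConn o a).card ∧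
        ((A.filter fun a => ω ∈ openConn o a).card : ℝ) <
          (∑ a ∈ A, (prodBernoulli w).real (openConn o a : Set (BondConfig (Fin n)))) / 2} ≤ 2 * δ := by
  have hmeas : ∀ s : Set (BondConfig (Fin n)), MeasurableSet s := fun _ => MeasurableSet.of_discrete
  refine oneCut_card_le_five_le_six n hn w A o (2 * δ) hA (by positivity) ?_
  intro a ha a' ha' _
  have hp := nhlts_pair w a a' b
  have hc : ∀ u v : Fin n, (prodBernoulli w).real (openConn u v : Set (BondConfig (Fin n)))ᶜ =
      1 - (prodBernoulli w).real (openConn u v : Set (BondConfig (Fin n))) :=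
    fun u v => probReal_compl_eq_one_sub (hmeas _)
  have h1 := hAb a ha
  have h2 := hAb a' ha'
  rw [hc] at h1 h2 ⊢
  linarith

/-- **Linear near-one gluing for `|A| ≤ 5` on at most six vertices, constant 4**: if `μ(a ↮ b) ≤ δ` for all `a ∈ A` then
`1 − μ(o ↔ b) ≤ (1 − μ(o ↔ A)) + 4δ`.  COMPUTATIONAL ancestry via `oneCut5_le_six`. [this work] -/
theorem linearGluing_card_le_five_le_six {n : ℕ} (hn : n ≤ 6) (w : Sym2 (Fin n) → unitInterval) (A : Finset (Fin n))
    (o b : Fin n) (hA : A.card ≤ 5) (δ : ℝ) (hδ : 0 ≤ δ)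
    (hAb : ∀ a ∈ A, (prodBernoulli w).real (openConn a b : Set (BondConfig (Fin n)))ᶜ ≤ δ) :
    1 - (prodBernoulli w).real (openConn o b : Set (BondConfig (Fin n))) ≤
      (1 - (prodBernoulli w).real (⋃ a ∈ A, (openConn o a : Set (BondConfig (Fin n))))) + 4 * δ :=
  linearGluing_of_oneCutAt w A o b δ hδ
    (fun t ht hp => oneCut_card_le_five_le_six n hn w A o t hA ht hp) hAb

end OneCutDownstream

end Summit.CriticalPhenomena.PercolationContinuityZ3.Theorems

end
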